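/-
Copyright (c) 2026. All rights reserved.
Released under Apache 2.0 license as described in the file LICENSE.
Authors: abc-iut cell, wave-2 discharge seat abc-iut-L3-t11 (proof-only companion of abc-iut-L6-t3's
`LocalLogShells.lean`, merging abc-iut-S1's `p`-adic logarithm).
-/
import Mathlib.Topology.Algebra.Valued.NormedValued
import Literature.IUT.LogThetaLattice.LocalLogShells
import Literature.IUT.LogVolume.LogSeriesEstimates
import HarnessLib

/-!
# [IUTchIII] Rmk 1.2.2 (i): `𝒪_k ⊆ ℐ_k` for the REAL `p`-adic logarithm (discharge of `IntegersSubsetLogShell`)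

Proof-only companion of `Literature/IUT/LogThetaLattice/LocalLogShells.lean` (seat abc-iut-L6-t3,
p403834). That file types [IUTchIII] Remark 1.2.2 (i) (Mochizuki, *Inter-universal Teichmüller Theory
III*, kurims manuscript May 2020, p. 36; claim key Mochizuki2012, status disputed — the item itself is a
classical fact the text RECALLS "at a more concrete level") over an ABSTRACT logarithm
`logk : Additive (↥O)ˣ →+ k` on the units of a valuation subring `O ⊆ k`, and records the one analytic
input — the second inclusion of (b^non), "`O_k^▷ := O_k \ {0} ⊆ O_k ⊆ I_k`" with
`I_k := (p_v^*)⁻¹ · log_k(O_k^×)` — as the PREDICATE `IntegersSubsetLogShell O logk p`, flagged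
`TODO-merge: abc-iut-S1`.

Seat abc-iut-S1 has since landed the `p`-adic logarithm `unitLog : K → K` on the units of a
mixed-characteristic nonarchimedean local field in the norm-side setting
(`Literature.IUT.LogVolume.LocalUnitLog`, p403893; Neukirch ANT II (5.4)–(5.5)) and the
successive-approximation surjectivity `exists_logSeries_eq` of the logarithmic series onto small balls
(`Literature.IUT.LogVolume.LogSeriesEstimates`, p404172; Koblitz GTM 58 Ch. IV §2). This file performs
the merge at the concrete level and DISCHARGES the predicate. Throughout, `K` is a nontrivially normed
field and normed `ℚ_p`-algebra with ultrametric norm (an MLF in the norm-side description; complete /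
proper where stated) and `O : ValuationSubring K` is ITS ring of integers, i.e. any valuation subring
with `x ∈ O ↔ ‖x‖ ≤ 1` (hypothesis `hO`; such an `O` exists, `exists_valuationSubring_iff_norm_le_one` —
the valuation subring of the norm-valuation).

* `norm_pStar_mul_rpow_lt_one` — with `ρ := ‖p^*‖` (`= p⁻¹` for odd `p`, `= 2⁻²` for `p = 2`) the
  contraction constant `θ = ρ · p^{1/(p−1)}` of `LogSeriesEstimates` is `< 1` for EVERY prime `p` (this is
  exactly why Def 1.1 (i) p. 24 squares `p` when `p = 2`: `2⁻¹ · 2 = 1` would not contract);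
* `integersSubsetLogShell_of_eq_unitLog` — for ANY additive `logk` on `O^×` that agrees with S1's
  `unitLog`, `IntegersSubsetLogShell O logk p` holds: given `a ∈ O`, `p^*·a = L(u)` for a principal unit
  `u` (`exists_logSeries_eq`), and `L(u) = log_p(u)`;
* `exists_addMonoidHom_eq_unitLog` — such a `logk` exists (`unitLog` is a homomorphism on units,
  `unitLog_mul`), so the hypothesis of the previous item is not vacuous, and
  `exists_logk_integersSubsetLogShell` assembles (b^non) and (c^non) of Rmk 1.2.2 (i) for it;
* `logUnits_eq_logUnits_of_eq_unitLog` — under the same agreement, the pre-log-shell `log_k(O_k^×)` of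
  `LocalLogShells.lean` IS S1's `Literature.IUT.LogVolume.logUnits K = log_p(R^×)`, and
  `nonarchLogShell_eq_image_logUnits` — the log-shell `I_k` is `(p^*)⁻¹ · log_p(R^×)`.

No new definitions (proof-only companion); nothing here bears on the disputed [IUTchIII] Cor. 3.12.
-/

noncomputable section

namespace Literature.IUT.LogThetaLattice

open Literature.IUT.LogVolume Literature.NumberTheory.Transcendental

variable (p : ℕ) [hp : Fact p.Prime]
variable (K : Type*) [NontriviallyNormedField K] [instK : NormedAlgebra ℚ_[p] K]
  [instU : IsUltrametricDist K]
include instK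

/-! ## The ring of integers `O_k = {‖x‖ ≤ 1}` as a valuation subring, and its units -/

omit instK in
/-- The ring of integers `O_k = {‖x‖ ≤ 1}` of an ultrametric normed field IS a valuation subring (the
valuation subring of the norm-valuation `NormedField.valuation`), so the hypothesis
`hO : ∀ x, x ∈ O ↔ ‖x‖ ≤ 1` used throughout this file is satisfiable ("`O_k` the ring of integers" of
the MLF `k`, Rmk 1.2.2 (i)). [cite: Mochizuki2012, III Rmk 1.2.2 (i) p.36] -/
theorem exists_valuationSubring_iff_norm_le_one :
    ∃ O : ValuationSubring K, ∀ x : K, x ∈ O ↔ ‖x‖ ≤ 1 := by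
  refine ⟨(NormedField.valuation (K := K)).valuationSubring, fun x => ?_⟩
  rw [Valuation.mem_valuationSubring_iff, NormedField.valuation_apply, ← NNReal.coe_le_coe,
    coe_nnnorm, NNReal.coe_one]

variable {K}
variable (O : ValuationSubring K)

omit instK instU in
/-- A unit of `O_k = {‖x‖ ≤ 1}` has norm `1` (`O_k^×` is the unit sphere, Rmk 1.2.2 (i)).
[cite: Mochizuki2012, III Rmk 1.2.2 (i) p.36] -/
theorem norm_coe_unit_of_iff_norm_le_one (hO : ∀ x : K, x ∈ O ↔ ‖x‖ ≤ 1) (u : (↥O)ˣ) :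
    ‖((u : ↥O) : K)‖ = 1 := by
  have h1 : ‖((u : ↥O) : K)‖ ≤ 1 := (hO _).mp (u : ↥O).2
  have h2 : ‖((↑(u⁻¹) : ↥O) : K)‖ ≤ 1 := (hO _).mp (↑(u⁻¹) : ↥O).2
  have h12 : ‖((u : ↥O) : K)‖ * ‖((↑(u⁻¹) : ↥O) : K)‖ = 1 := by
    rw [← norm_mul, ← MulMemClass.coe_mul, Units.mul_inv, OneMemClass.coe_one, norm_one]
  exact le_antisymm h1 (by nlinarith [norm_nonneg ((u : ↥O) : K), norm_nonneg ((↑(u⁻¹) : ↥O) : K)])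

omit instK instU in
/-- Conversely every `u ∈ K` with `‖u‖ = 1` is (the image of) a unit of `O_k = {‖x‖ ≤ 1}`.
[cite: Mochizuki2012, III Rmk 1.2.2 (i) p.36] -/
theorem exists_unit_coe_eq_of_norm_eq_one (hO : ∀ x : K, x ∈ O ↔ ‖x‖ ≤ 1) {u : K} (hu : ‖u‖ = 1) :
    ∃ x : (↥O)ˣ, ((x : ↥O) : K) = u := by
  have hu0 : u ≠ 0 := norm_pos_iff.mp (by rw [hu]; exact one_pos)
  have hmem : u ∈ O := (hO u).mpr hu.le
  have hmem' : u⁻¹ ∈ O := (hO _).mpr (by rw [norm_inv, hu, inv_one])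
  refine ⟨⟨⟨u, hmem⟩, ⟨u⁻¹, hmem'⟩, ?_, ?_⟩, rfl⟩
  · exact Subtype.ext (mul_inv_cancel₀ hu0)
  · exact Subtype.ext (inv_mul_cancel₀ hu0)

/-! ## The normalising factor `p^*` in `K` -/

variable (K)

omit instU in
/-- `p^* ≠ 0` in `K` (characteristic `0`). [cite: Mochizuki2012, III Def 1.1 (i) p.24] -/
theorem pStar_cast_ne_zero : ((pStar p : ℕ) : K) ≠ 0 := by
  haveI := IwasawaLog.charZero p (F := K)
  exact_mod_cast pStar_ne_zero (Fact.out : p.Prime).ne_zero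

omit instU in
/-- **Why `p^* = p²` for `p = 2`**: with `ρ := ‖p^*‖` the contraction constant
`θ := ρ · p^{1/(p−1)}` of the logarithmic series is `< 1` for every prime `p`
(`p` odd: `θ = p^{1/(p−1) − 1} < 1`; `p = 2`: `θ = 2⁻² · 2 = 2⁻¹`).
[cite: Mochizuki2012, III Def 1.1 (i) p.24] -/
theorem norm_pStar_mul_rpow_lt_one :
    ‖((pStar p : ℕ) : K)‖ * (p : ℝ) ^ (1 / ((p : ℝ) - 1)) < 1 := by
  have hp : p.Prime := Fact.out
  have hp1 : (1 : ℝ) < p := by exact_mod_cast hp.one_lt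
  have hnp : ‖(p : K)‖ = (p : ℝ)⁻¹ := by rw [IwasawaLog.norm_natCast p p, Padic.norm_p]
  rcases hp.eq_two_or_odd' with h2 | hodd
  · -- `p = 2`: `‖4‖ · 2^{1} = 2⁻¹`
    subst h2
    have h4 : ((pStar 2 : ℕ) : K) = (2 : ℕ) ^ 2 := by rw [pStar_two]; norm_num
    rw [h4, norm_pow, hnp]
    norm_num
  · -- `p` odd: `p⁻¹ · p^{1/(p-1)} = p^{1/(p-1) - 1}` with a negative exponent
    have h3 : (3 : ℝ) ≤ p := by
      have h2 : p ≠ 2 := by rintro rfl; exact absurd hodd (by decide)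
      exact_mod_cast (show 3 ≤ p by have := hp.two_le; omega)
    rw [pStar_of_odd hodd, hnp, ← Real.rpow_neg_one, ← Real.rpow_add (by linarith)]
    apply Real.rpow_lt_one_of_one_lt_of_neg hp1
    have : 1 / ((p : ℝ) - 1) < 1 := (div_lt_one (by linarith)).mpr (by linarith)
    linarith

omit instU in
/-- `‖p^*‖ < 1` (`p^*` lies in the maximal ideal). [cite: Mochizuki2012, III Def 1.1 (i) p.24] -/
theorem norm_pStar_lt_one : ‖((pStar p : ℕ) : K)‖ < 1 := by
  have hp1 : (1 : ℝ) ≤ p := by exact_mod_cast (Fact.out : p.Prime).one_lt.le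
  have hq : 1 ≤ (p : ℝ) ^ (1 / ((p : ℝ) - 1)) :=
    Real.one_le_rpow hp1 (div_nonneg zero_le_one (by linarith))
  calc ‖((pStar p : ℕ) : K)‖ = ‖((pStar p : ℕ) : K)‖ * 1 := (mul_one _).symm
    _ ≤ ‖((pStar p : ℕ) : K)‖ * (p : ℝ) ^ (1 / ((p : ℝ) - 1)) := by gcongr
    _ < 1 := norm_pStar_mul_rpow_lt_one p K

variable {K}

/-! ## Discharge of `IntegersSubsetLogShell` at the real logarithm -/

/-- **Rmk 1.2.2 (i), (b^non), second inclusion `O_k ⊆ I_k := (p^*)⁻¹ · log_k(O_k^×)` — PROVED for the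
`p`-adic logarithm**: if `logk` agrees with S1's `unitLog = log_p` on `O_k^×`, then every `a ∈ O_k` is
`(p^*)⁻¹ · log_k(u)` for the principal unit `u` with `L(u) = p^*·a` supplied by successive approximation
(`exists_logSeries_eq`, radius `ρ = ‖p^*‖`, `θ = ρ·p^{1/(p−1)} < 1`). This discharges the predicate
`IntegersSubsetLogShell` of `LocalLogShells.lean` (TODO-merge abc-iut-S1) for a complete `K`.
[cite: Mochizuki2012, III Rmk 1.2.2 (i) p.36] -/
theorem integersSubsetLogShell_of_eq_unitLog [CompleteSpace K] (hO : ∀ x : K, x ∈ O ↔ ‖x‖ ≤ 1)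
    (logk : Additive (↥O)ˣ →+ K)
    (hlog : ∀ u : (↥O)ˣ, logk (Additive.ofMul u) = unitLog ((u : ↥O) : K)) :
    IntegersSubsetLogShell O logk p := by
  refine ⟨fun a ha => ?_⟩
  have ha1 : ‖a‖ ≤ 1 := (hO a).mp ha
  have hθ := norm_pStar_mul_rpow_lt_one p K
  have hz : ‖((pStar p : ℕ) : K) * a‖ ≤ ‖((pStar p : ℕ) : K)‖ := by
    rw [norm_mul]; exact mul_le_of_le_one_right (norm_nonneg _) ha1
  obtain ⟨u, hu, hLu⟩ := exists_logSeries_eq p K hθ hz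
  have huP : IsPrincipal u := hu.trans_lt (norm_pStar_lt_one p K)
  obtain ⟨x, hx⟩ := exists_unit_coe_eq_of_norm_eq_one O hO huP.norm_eq_one
  refine ⟨x, ?_⟩
  rw [hlog x, hx, unitLog_of_isPrincipal p huP, hLu, ← mul_assoc,
    inv_mul_cancel₀ (pStar_cast_ne_zero p K), one_mul]

/-- (b^non) of Rmk 1.2.2 (i) assembled for the real logarithm: `O_k^▷ ⊆ I_k`.
[cite: Mochizuki2012, III Rmk 1.2.2 (i) p.36] -/
theorem nonzeroIntegers_subset_logShell_of_eq_unitLog [CompleteSpace K]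
    (hO : ∀ x : K, x ∈ O ↔ ‖x‖ ≤ 1) (logk : Additive (↥O)ˣ →+ K)
    (hlog : ∀ u : (↥O)ˣ, logk (Additive.ofMul u) = unitLog ((u : ↥O) : K)) :
    nonzeroIntegers O ⊆ nonarchLogShell O logk p :=
  nonzeroIntegers_subset_logShell O logk p (integersSubsetLogShell_of_eq_unitLog p O hO logk hlog)

omit instU in
/-- (c^non) of Rmk 1.2.2 (i) over a `p`-adic field: `log_k(O_k^×) ⊆ I_k`, for ANY valuation subring
`O ⊆ K` and any `logk` (only `p^* ≠ 0` in `K` is needed). [cite: Mochizuki2012, III Rmk 1.2.2 (i) p.36] -/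
theorem logUnits_subset_logShell_padicField (logk : Additive (↥O)ˣ →+ K) :
    logUnits O logk ⊆ nonarchLogShell O logk p :=
  logUnits_subset_nonarchLogShell O logk p (pStar_cast_ne_zero p K)

/-! ## The agreement hypothesis is satisfiable: `unitLog` as a homomorphism on `O_k^×` -/

/-- S1's `unitLog = log_p` IS an additive homomorphism on `O_k^×` (`unitLog_mul`): there is
`logk : Additive (O_k)^× →+ K` with `logk(u) = log_p(u)` for every unit `u` — the `log_k : O_k^× → k`
of Rmk 1.2.2 (i). (Stated as an existence theorem so that this companion adds no definitions.)
[cite: Mochizuki2012, III Rmk 1.2.2 (i) p.36] -/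
theorem exists_addMonoidHom_eq_unitLog [ProperSpace K] (hO : ∀ x : K, x ∈ O ↔ ‖x‖ ≤ 1) :
    ∃ logk : Additive (↥O)ˣ →+ K,
      ∀ u : (↥O)ˣ, logk (Additive.ofMul u) = unitLog ((u : ↥O) : K) := by
  refine ⟨AddMonoidHom.mk' (fun x => unitLog (((Additive.toMul x : (↥O)ˣ) : ↥O) : K)) ?_,
    fun u => rfl⟩
  intro x y
  simp only [toMul_add, Units.val_mul, MulMemClass.coe_mul]
  exact unitLog_mul p (norm_coe_unit_of_iff_norm_le_one O hO _)
    (norm_coe_unit_of_iff_norm_le_one O hO _)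

/-- **Rmk 1.2.2 (i) at the real logarithm, assembled**: for the MLF `K` (finite over `ℚ_p`: proper)
with ring of integers `O = {‖x‖ ≤ 1}` there is a logarithm `logk` on `O^×` equal to `log_p`, and for it
`O_k^▷ ⊆ O_k ⊆ I_k` ((b^non), incl. the discharged `IntegersSubsetLogShell`) and `log_k(O_k^×) ⊆ I_k`
((c^non)). [cite: Mochizuki2012, III Rmk 1.2.2 (i) p.36] -/
theorem exists_logk_integersSubsetLogShell [ProperSpace K] (hO : ∀ x : K, x ∈ O ↔ ‖x‖ ≤ 1) :
    ∃ logk : Additive (↥O)ˣ →+ K,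
      (∀ u : (↥O)ˣ, logk (Additive.ofMul u) = unitLog ((u : ↥O) : K)) ∧
      IntegersSubsetLogShell O logk p ∧
      nonzeroIntegers O ⊆ (O : Set K) ∧
      (O : Set K) ⊆ nonarchLogShell O logk p ∧
      logUnits O logk ⊆ nonarchLogShell O logk p := by
  obtain ⟨logk, hlog⟩ := exists_addMonoidHom_eq_unitLog p O hO
  exact ⟨logk, hlog, integersSubsetLogShell_of_eq_unitLog p O hO logk hlog, nonzeroIntegers_subset _,
    (integersSubsetLogShell_of_eq_unitLog p O hO logk hlog).subset,
    logUnits_subset_logShell_padicField p O logk⟩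

/-- The same with the ring of integers also produced (not assumed): over a proper `K` there are a
valuation subring `O = {‖x‖ ≤ 1}` and a logarithm `logk = log_p` on `O^×` for which
`IntegersSubsetLogShell O logk p` holds. [cite: Mochizuki2012, III Rmk 1.2.2 (i) p.36] -/
theorem exists_integersSubsetLogShell_unitLog [ProperSpace K] :
    ∃ (O : ValuationSubring K) (logk : Additive (↥O)ˣ →+ K),
      (∀ x : K, x ∈ O ↔ ‖x‖ ≤ 1) ∧
      (∀ u : (↥O)ˣ, logk (Additive.ofMul u) = unitLog ((u : ↥O) : K)) ∧
      IntegersSubsetLogShell O logk p := by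
  obtain ⟨O, hO⟩ := exists_valuationSubring_iff_norm_le_one K
  obtain ⟨logk, hlog, hI, -⟩ := exists_logk_integersSubsetLogShell p O hO
  exact ⟨O, logk, hO, hlog, hI⟩

/-! ## Bridge to S1's `log_p(R^×)` -/

omit hp instK instU in
/-- Under the agreement `logk = log_p` on units, the pre-log-shell `log_k(O_k^×)` of
`LocalLogShells.lean` is S1's `logUnits K = log_p(R^×)` ([IUTchIV] Prop 1.2; the UNSCALED pre-log-shell
of [AbsTopIII] Def 3.1 (iv)). [cite: Mochizuki2012, III Def 1.1 (i) p.24] -/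
theorem logUnits_eq_logUnits_of_eq_unitLog (hO : ∀ x : K, x ∈ O ↔ ‖x‖ ≤ 1)
    (logk : Additive (↥O)ˣ →+ K)
    (hlog : ∀ u : (↥O)ˣ, logk (Additive.ofMul u) = unitLog ((u : ↥O) : K)) :
    logUnits O logk = LogVolume.logUnits K := by
  ext z
  rw [LogVolume.mem_logUnits_iff]
  constructor
  · rintro ⟨x, rfl⟩
    exact ⟨((x : ↥O) : K), norm_coe_unit_of_iff_norm_le_one O hO x, (hlog x).symm⟩
  · rintro ⟨u, hu, rfl⟩
    obtain ⟨x, hx⟩ := exists_unit_coe_eq_of_norm_eq_one O hO hu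
    exact ⟨x, by rw [← hx]; exact hlog x⟩

omit hp instK instU in
/-- … and the log-shell `I_k = (p^*)⁻¹ · log_k(O_k^×)` is `(p^*)⁻¹ · log_p(R^×)` ("the result of
multiplying the pre-log-shell by the factor `(p_v^*)⁻¹`", Def 1.1 (i) p. 24).
[cite: Mochizuki2012, III Def 1.1 (i) p.24] -/
theorem nonarchLogShell_eq_image_logUnits (hO : ∀ x : K, x ∈ O ↔ ‖x‖ ≤ 1)
    (logk : Additive (↥O)ˣ →+ K)
    (hlog : ∀ u : (↥O)ˣ, logk (Additive.ofMul u) = unitLog ((u : ↥O) : K)) :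
    nonarchLogShell O logk p = (fun z => ((pStar p : ℕ) : K)⁻¹ * z) '' LogVolume.logUnits K := by
  rw [← logUnits_eq_logUnits_of_eq_unitLog O hO logk hlog]
  ext a
  constructor
  · rintro ⟨x, rfl⟩
    exact ⟨logk (Additive.ofMul x), ⟨x, rfl⟩, rfl⟩
  · rintro ⟨_, ⟨x, rfl⟩, rfl⟩
    exact ⟨x, rfl⟩

end Literature.IUT.LogThetaLattice

end
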